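import Summits.Ventures.CertifiedArithmetic.LowPrec.SRPythagorasOneBitFormats
import Summits.Ventures.CertifiedArithmetic.LowPrec.SRConstantIncrementLaw
import HarnessLib

/-!
# Stochastic rounding in low-precision formats, CV: the one-bit Pythagorean law is SHARP for every
# run length — constant-increment witnesses with residual `θ ↑ 1`

HONEST FRAMING: certified error envelopes and provably optimal rounding/accumulation schemes for
low-precision formats under stated cost models; every table by two implementations; no hardware or
vendor claims.

File CIV (`SRPythagorasOneBitFormats`, `stochasticA_one_acc_sq_le`) proved: truncated stochastic
rounding with ONE random bit (IEEE P3109 `StochasticA`, `N = 1`) obeys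
`E(ŝₙ − sₙ)² ≤ n·G²/4 + (n·G/2)²` on every unsaturated outcome tree of every finite value set whose
candidate gaps are `≤ G`; the kernel instance `Formats.e3m2_oneBit_nearTight` reached the ratio
`11721/12288 ≈ 0.954` at `n = 3`.  This file proves that the constant is OPTIMAL FOR EVERY `n`:

* `const_run_noSat`, `const_run_gapLE` — a constant-increment run inside a uniform segment (file CII,
  `UniformSeg F g ε M`: the `M + 1` consecutive members `g + iε`) never saturates and meets only gaps
  `= ε`; so the hypotheses `NoSat`, `GapLE ε` of the law hold on these trees (any rule `q`).
* `probAwayA_one_eq_half`, `const_run_stochasticA_one` — with one bit and residual `θ ∈ [1/2, 1)` the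
  up-probability is exactly `1/2` at every step, and by the binomial law of file CII the mean-square
  error of `L` increments `(a + θ)ε` is EXACTLY `L·ε²/4 + (L(θ − 1/2)ε)²`.
* **`stochasticA_one_sharp` (sharpness family).** For `θ_k = 1 − 1/(2(k+2))` (`k = 0, 1, 2, …`;
  `θ_0 = 3/4` is the kernel instance of file CII) and every run length `L ≤ M`:
  the tree satisfies `NoSat` and `GapLE ε`, its MSE is `L·ε²/4 + (L·(k+1)/(2(k+2))·ε)²`, and
  `LAW − L²ε²/(2(k+2)) ≤ MSE ≤ LAW` with `LAW = L·ε²/4 + (L·2^{-1}·ε)²` — the bound of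
  `stochasticA_one_acc_sq_le` with `G = ε`.  Hence `sup MSE = LAW` over admissible trees: the one-bit
  constant cannot be lowered by any amount, for any `n` (the supremum is not attained: `θ = 1` is a grid
  point).  The same witnesses show that the `ε = 1/2`-class law `accExpQ_sq_le_of_sameSide` of file
  CIII is sharp within the class (one-bit `StochasticA` is sign-consistent, CIV `probAwayA_sameSide`).
* `Formats.valueSet_stochasticA_one_sharp` — in EVERY binary format, in every binade below the top
  (`j + 2 ≤ emaxCode`, gap `ε = 2^j·q`), for every run length `L ≤ 2^manBits`: the same five facts on
  the true value set `valueSet φ`.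
* `intSeg`, `oneBit_sharp_every_n`, `oneBit_sharp_sup` — on the integers `{0, 1, …, n} ⊂ ℚ` (gap `1`):
  for EVERY `n` and every `δ > 0` an admissible one-bit tree with `E(ŝₙ − sₙ)² > n/4 + n²/4 − δ`.
* Cross-checks: `thetaSharp_zero` (`θ_0 = 3/4`, the kernel instance of file CII) and
  `e3m2_nearTight_in_family` — the near-tight kernel tree of file CIV is the member `k = 30`
  (`θ_30 = 63/64`): its MSE `11721/1024` now follows from the closed form instead of `decide`.

Scope, stated exactly: the witnesses are one-signed constant-increment runs inside ONE cell width
(no binade crossing); they certify optimality of the constant in the window law (`G` = the gap met).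
For the whole-range corollary `valueSet_stochasticA_one` (`G = 2^(emaxCode−1)·q`, the top gap) the
family below the top binade only reaches `G/2`; optimality of that corollary's constant is NOT claimed.
The fixed-summand law for `StochasticA` with `2 ≤ N ≤ emaxCode − 2` bits remains OPEN (file CIV).

References: [ConnollyHighamMary2021] Thm 4.3/4.6 (exact SR, `√n` growth); [ElararEtAl2025, Lemma 3.3]
(per-operation bias `u_{p+r}` of `SR_{p,r}`; its coherent accumulation is the squared-bias term here);
IEEE P3109 interim report (StochasticA).  No source states an accumulated mean-square law for one
random bit, let alone its sharpness (cell FRESHNESS-SR QUESTION S).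
-/

namespace Summit.Ventures.CertifiedArithmetic.LowPrec.SR.LimitedBits

open Literature.ComputerArithmetic.ConnollyHighamMary2021
open Summit.Ventures.CertifiedArithmetic.LowPrec.SR
open Finset

section Generic

variable {K : Type*} [Field K] [LinearOrder K] [IsStrictOrderedRing K]

/-- A constant-increment run inside a uniform segment never saturates (any rule). -/
theorem const_run_noSat {F : Finset K} {g ε θ : K} {M : ℕ} (hS : UniformSeg F g ε M) (hε : 0 < ε)
    (hθ0 : 0 < θ) (hθ1 : θ < 1) (a : ℕ) :
    ∀ (L i : ℕ), i + L * (a + 1) ≤ M → NoSat F (fun _ => ((a : K) + θ) * ε) L (g + (i : K) * ε)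
  | 0, _, _ => trivial
  | L + 1, i, hi => by
    have e1 : (L + 1) * (a + 1) = L * (a + 1) + (a + 1) := Nat.succ_mul L (a + 1)
    have hia : i + a < M := by omega
    obtain ⟨hd, hu, -⟩ := const_step_cell hS hε hθ0 hθ1 hia
    refine ⟨⟨⟨_, hS.mem (i + a) hia.le, ?_⟩, ⟨_, hS.mem (i + a + 1) hia, ?_⟩⟩, ?_, ?_⟩
    · have := mul_pos hθ0 hε
      push_cast; linarith
    · have := mul_lt_mul_of_pos_right hθ1 hε
      push_cast; linarith
    · show NoSat F (fun _ => ((a : K) + θ) * ε) L (up F (g + (i : K) * ε + ((a : K) + θ) * ε))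
      rw [hu]; exact const_run_noSat hS hε hθ0 hθ1 a L (i + a + 1) (by omega)
    · show NoSat F (fun _ => ((a : K) + θ) * ε) L (dn F (g + (i : K) * ε + ((a : K) + θ) * ε))
      rw [hd]; exact const_run_noSat hS hε hθ0 hθ1 a L (i + a) (by omega)

/-- A constant-increment run inside a uniform segment meets only candidate gaps `= ε` (any rule). -/
theorem const_run_gapLE {F : Finset K} {g ε θ : K} {M : ℕ} (hS : UniformSeg F g ε M) (hε : 0 < ε)
    (hθ0 : 0 < θ) (hθ1 : θ < 1) (a : ℕ) :
    ∀ (L i : ℕ), i + L * (a + 1) ≤ M → GapLE F ε (fun _ => ((a : K) + θ) * ε) L (g + (i : K) * ε)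
  | 0, _, _ => trivial
  | L + 1, i, hi => by
    have e1 : (L + 1) * (a + 1) = L * (a + 1) + (a + 1) := Nat.succ_mul L (a + 1)
    have hia : i + a < M := by omega
    obtain ⟨hd, hu, -⟩ := const_step_cell hS hε hθ0 hθ1 hia
    refine ⟨?_, ?_, ?_⟩
    · show up F (g + (i : K) * ε + ((a : K) + θ) * ε) - dn F (g + (i : K) * ε + ((a : K) + θ) * ε) ≤ ε
      rw [hu, hd]; push_cast; linarith
    · show GapLE F ε (fun _ => ((a : K) + θ) * ε) L (up F (g + (i : K) * ε + ((a : K) + θ) * ε))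
      rw [hu]; exact const_run_gapLE hS hε hθ0 hθ1 a L (i + a + 1) (by omega)
    · show GapLE F ε (fun _ => ((a : K) + θ) * ε) L (dn F (g + (i : K) * ε + ((a : K) + θ) * ε))
      rw [hd]; exact const_run_gapLE hS hε hθ0 hθ1 a L (i + a) (by omega)

end Generic

section Floor

variable {K : Type*} [Field K] [LinearOrder K] [IsStrictOrderedRing K] [FloorRing K]

/-- With one random bit, every residual in `[1/2, 1)` is rounded up with probability exactly `1/2`. -/
theorem probAwayA_one_eq_half {θ : K} (h0 : 1 / 2 ≤ θ) (h1 : θ < 1) : probAwayA 1 θ = 1 / 2 := by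
  have hf : ⌊θ * 2 ^ 1⌋ = (1 : ℤ) := by
    rw [Int.floor_eq_iff]; push_cast; constructor <;> linarith
  unfold probAwayA; rw [hf]; push_cast; norm_num

/-- **Exact MSE of a one-bit run with residual `θ ∈ [1/2, 1)`:** `L·ε²/4 + (L(θ − 1/2)ε)²` (file CII's
binomial law with `p = A_1(θ) = 1/2`). -/
theorem const_run_stochasticA_one {F : Finset K} {g ε θ : K} {M : ℕ} (hS : UniformSeg F g ε M)
    (hg : 0 ≤ g) (hε : 0 < ε) (hθ0 : 1 / 2 ≤ θ) (hθ1 : θ < 1) (a : ℕ) {L i : ℕ}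
    (hi : i + L * (a + 1) ≤ M) :
    accExpQ F (probAwayA 1) (fun _ => ((a : K) + θ) * ε) L
        (fun y => (y - (g + (i : K) * ε + L * (((a : K) + θ) * ε))) ^ 2) (g + (i : K) * ε)
      = L * (ε ^ 2 / 4) + (L * ((θ - 1 / 2) * ε)) ^ 2 := by
  have h := (const_run_stochasticA 1 hS hg hε (by linarith) hθ1 a hi).2.2.2
  rw [h, probAwayA_one_eq_half hθ0 hθ1]; ring

/-- The witness residuals `θ_k = 1 − 1/(2(k+2))`: `3/4, 5/6, 7/8, …  ↑ 1`. -/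
def thetaSharp (K : Type*) [Field K] (k : ℕ) : K := 1 - 1 / (2 * ((k : K) + 2))

omit [FloorRing K] in
/-- `θ_k − 1/2 = (k+1)/(2(k+2))`. -/
theorem thetaSharp_sub_half (k : ℕ) (hk : (2 : K) * ((k : K) + 2) ≠ 0) :
    thetaSharp K k - 1 / 2 = ((k : K) + 1) / (2 * ((k : K) + 2)) := by
  unfold thetaSharp
  rw [eq_div_iff hk, sub_mul, sub_mul, div_mul_cancel₀ _ hk]
  ring

/-- **SHARPNESS OF THE ONE-BIT LAW, every run length.** On a nonnegative uniform segment
(`M + 1` consecutive members `g + iε` of `F`), the one-bit `StochasticA` accumulation of `L ≤ M` copies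
of `θ_k·ε` from `g`: no saturation, all gaps `= ε`, MSE exactly `L·ε²/4 + (L·(k+1)/(2(k+2))·ε)²`, and
`LAW − L²ε²/(2(k+2)) ≤ MSE ≤ LAW` where `LAW = L·ε²/4 + (L·2^{-1}·ε)²` is the bound of
`stochasticA_one_acc_sq_le` (file CIV) with `G = ε`.  Letting `k → ∞`: the constant is optimal. -/
theorem stochasticA_one_sharp {F : Finset K} {g ε : K} {M : ℕ} (hS : UniformSeg F g ε M)
    (hg : 0 ≤ g) (hε : 0 < ε) {L : ℕ} (hL : L ≤ M) (k : ℕ) :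
    NoSat F (fun _ => thetaSharp K k * ε) L g ∧
      GapLE F ε (fun _ => thetaSharp K k * ε) L g ∧
      accExpQ F (probAwayA 1) (fun _ => thetaSharp K k * ε) L
          (fun y => (y - (g + L * (thetaSharp K k * ε))) ^ 2) g
        = L * (ε ^ 2 / 4) + (L * (((k : K) + 1) / (2 * ((k : K) + 2)) * ε)) ^ 2 ∧
      L * (ε ^ 2 / 4) + (L * (1 / 2 ^ 1 * ε)) ^ 2 - (L : K) ^ 2 * ε ^ 2 / (2 * ((k : K) + 2))
        ≤ accExpQ F (probAwayA 1) (fun _ => thetaSharp K k * ε) L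
            (fun y => (y - (g + L * (thetaSharp K k * ε))) ^ 2) g ∧
      accExpQ F (probAwayA 1) (fun _ => thetaSharp K k * ε) L
          (fun y => (y - (g + L * (thetaSharp K k * ε))) ^ 2) g
        ≤ L * (ε ^ 2 / 4) + (L * (1 / 2 ^ 1 * ε)) ^ 2 := by
  have ht : (0 : K) < 2 * ((k : K) + 2) := by positivity
  have hθ0 : (1 : K) / 2 ≤ thetaSharp K k := by
    unfold thetaSharp
    have : 1 / (2 * ((k : K) + 2)) ≤ (1 : K) / 2 := by
      rw [div_le_div_iff₀ ht (by norm_num : (0 : K) < 2)]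
      have : (0 : K) ≤ k := Nat.cast_nonneg k
      linarith
    linarith
  have hθ1 : thetaSharp K k < 1 := by
    unfold thetaSharp; have := div_pos one_pos ht; linarith
  have hθ0' : (0 : K) < thetaSharp K k := by linarith
  have hi : 0 + L * (0 + 1) ≤ M := by simpa using hL
  have h1 := const_run_noSat hS hε hθ0' hθ1 0 L 0 hi
  have h2 := const_run_gapLE hS hε hθ0' hθ1 0 L 0 hi
  have h3 := const_run_stochasticA_one hS hg hε hθ0 hθ1 0 hi
  simp only [Nat.cast_zero, zero_add, zero_mul, add_zero] at h1 h2 h3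
  rw [thetaSharp_sub_half k ht.ne'] at h3
  have key : (L : K) * (ε ^ 2 / 4) + (L * (((k : K) + 1) / (2 * ((k : K) + 2)) * ε)) ^ 2
      = L * (ε ^ 2 / 4) + (L * (1 / 2 ^ 1 * ε)) ^ 2 - (L : K) ^ 2 * ε ^ 2 / (2 * ((k : K) + 2))
        + (L : K) ^ 2 * ε ^ 2 / (2 * ((k : K) + 2)) ^ 2 := by
    field_simp; ring
  have hpos : (0 : K) ≤ (L : K) ^ 2 * ε ^ 2 / (2 * ((k : K) + 2)) ^ 2 := by positivity
  have hgap : (L : K) ^ 2 * ε ^ 2 / (2 * ((k : K) + 2)) ^ 2 ≤ (L : K) ^ 2 * ε ^ 2 / (2 * ((k : K) + 2)) := by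
    rw [div_le_div_iff₀ (by positivity) ht]
    have hL2 : (0 : K) ≤ (L : K) ^ 2 * ε ^ 2 := by positivity
    have h4 : 2 * ((k : K) + 2) ≤ (2 * ((k : K) + 2)) ^ 2 := by
      have : (0 : K) ≤ k := Nat.cast_nonneg k
      nlinarith
    exact mul_le_mul_of_nonneg_left h4 hL2
  refine ⟨h1, h2, h3, ?_, ?_⟩
  · rw [h3, key]; linarith
  · rw [h3, key]; linarith

end Floor

end Summit.Ventures.CertifiedArithmetic.LowPrec.SR.LimitedBits

/-! ### Every binary format, every binade below the top; and every `n` on the integers -/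

namespace Summit.Ventures.CertifiedArithmetic.LowPrec.SR.Formats

open Literature.ComputerArithmetic.ConnollyHighamMary2021
open Literature.ComputerArithmetic.FloatingPoint
open Summit.Ventures.CertifiedArithmetic.LowPrec.SR
open Summit.Ventures.CertifiedArithmetic.LowPrec.SR.LimitedBits
open MiniFloat Finset

/-- **Sharpness in every binary format.** Binade `j` (`j + 2 ≤ emaxCode`; base point
`g = 2^(manBits+j)·q`, gap `ε = 2^j·q`), run length `L ≤ 2^manBits`, witness `θ_k`: the one-bit
`StochasticA` tree is unsaturated with gaps `= ε`, and its MSE lies within `L²ε²/(2(k+2))` of the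
bound `L·ε²/4 + (L·2^{-1}·ε)²` of `stochasticA_one_acc_sq_le`, never above it. -/
theorem valueSet_stochasticA_one_sharp (φ : Format) {j : ℕ} (hj : j + 2 ≤ φ.emaxCode) {L : ℕ}
    (hL : L ≤ 2 ^ φ.manBits) (k : ℕ) :
    let g : ℚ := (2 : ℚ) ^ (φ.manBits + j) * φ.quantum
    let ε : ℚ := 2 ^ j * φ.quantum
    NoSat (valueSet φ) (fun _ => thetaSharp ℚ k * ε) L g ∧
      GapLE (valueSet φ) ε (fun _ => thetaSharp ℚ k * ε) L g ∧
      accExpQ (valueSet φ) (probAwayA 1) (fun _ => thetaSharp ℚ k * ε) L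
          (fun y => (y - (g + L * (thetaSharp ℚ k * ε))) ^ 2) g
        = L * (ε ^ 2 / 4) + (L * (((k : ℚ) + 1) / (2 * ((k : ℚ) + 2)) * ε)) ^ 2 ∧
      L * (ε ^ 2 / 4) + (L * (1 / 2 ^ 1 * ε)) ^ 2 - (L : ℚ) ^ 2 * ε ^ 2 / (2 * ((k : ℚ) + 2))
        ≤ accExpQ (valueSet φ) (probAwayA 1) (fun _ => thetaSharp ℚ k * ε) L
            (fun y => (y - (g + L * (thetaSharp ℚ k * ε))) ^ 2) g ∧
      accExpQ (valueSet φ) (probAwayA 1) (fun _ => thetaSharp ℚ k * ε) L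
          (fun y => (y - (g + L * (thetaSharp ℚ k * ε))) ^ 2) g
        ≤ L * (ε ^ 2 / 4) + (L * (1 / 2 ^ 1 * ε)) ^ 2 := by
  have hq := φ.quantum_pos
  exact stochasticA_one_sharp (valueSet_binade_uniformSeg φ hj) (by positivity) (by positivity) hL k


/-- `θ_0 = 3/4`: the kernel instance of file CII (`Formats.e2m1_const_run_one_bit`: E2M1, increments
`3/8 = θ_0 · (1/2)`, two steps, MSE `3/16 = 2·(1/2)²/4 + (2·(1/4)·(1/2))²`) is the first family member. -/
theorem thetaSharp_zero : thetaSharp ℚ 0 = 3 / 4 := by norm_num [thetaSharp]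

/-- The near-tight kernel tree of file CIV (`Formats.e3m2_oneBit_nearTight`: E3M2 `[8, 16]`, from `8`
three summands `63/32`, MSE `11721/1024` against `12`) is the family member `k = 30` (`θ_30 = 63/64`,
binade `j = 5`, gap `2`) — here obtained from the closed form, not by `decide`. -/
theorem e3m2_nearTight_in_family :
    accExpQ e3m2 (probAwayA 1) (fun _ => (63 / 32 : ℚ)) 3 (fun y => (y - 445 / 32) ^ 2) 8
      = 11721 / 1024 := by
  have h := (valueSet_stochasticA_one_sharp Format.E3M2 (j := 5) (by decide) (L := 3) (by decide)
    30).2.2.1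
  have hq : Format.E3M2.quantum = 1 / 16 := by decide +kernel
  have hm : Format.E3M2.manBits = 2 := rfl
  have ht : thetaSharp ℚ 30 = 63 / 64 := by norm_num [thetaSharp]
  rw [hq, hm, ht, ← e3m2_eq_valueSet] at h
  norm_num at h ⊢
  exact h

/-- The integers `{0, 1, …, n}` as a value set in `ℚ`. -/
def intSeg (n : ℕ) : Finset ℚ := (range (n + 1)).image (fun i : ℕ => (i : ℚ))

/-- The integers `{0, …, n}` form a uniform segment with base `0`, gap `1`, `n` cells. -/
theorem intSeg_uniformSeg (n : ℕ) : UniformSeg (intSeg n) 0 1 n where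
  mem i hi := by
    simp only [intSeg, mem_image, mem_range, zero_add, mul_one]
    exact ⟨i, by omega, rfl⟩
  gap i _ y hy := by
    simp only [intSeg, mem_image, mem_range] at hy
    obtain ⟨j, -, rfl⟩ := hy
    rcases le_or_gt j i with h | h
    · left; simpa using (Nat.cast_le.mpr h : (j : ℚ) ≤ i)
    · right; simpa using (Nat.cast_le.mpr h : ((i + 1 : ℕ) : ℚ) ≤ j)

/-- **Sharp for EVERY `n`.** On `{0, …, n} ⊂ ℚ` (all gaps `1`), from `0`, `n` copies of `θ_k`, one
random bit: admissible (`NoSat`, `GapLE 1`), MSE `= n/4 + (n(k+1)/(2(k+2)))²`, within `n²/(2(k+2))` of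
the law `n/4 + (n/2)²` and never above it. -/
theorem oneBit_sharp_every_n (n k : ℕ) :
    NoSat (intSeg n) (fun _ => thetaSharp ℚ k) n 0 ∧
      GapLE (intSeg n) 1 (fun _ => thetaSharp ℚ k) n 0 ∧
      accExpQ (intSeg n) (probAwayA 1) (fun _ => thetaSharp ℚ k) n
          (fun y => (y - n * thetaSharp ℚ k) ^ 2) 0
        = n * (1 / 4 : ℚ) + (n * (((k : ℚ) + 1) / (2 * ((k : ℚ) + 2)))) ^ 2 ∧
      n * (1 / 4 : ℚ) + (n * (1 / 2 ^ 1 : ℚ)) ^ 2 - (n : ℚ) ^ 2 / (2 * ((k : ℚ) + 2))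
        ≤ accExpQ (intSeg n) (probAwayA 1) (fun _ => thetaSharp ℚ k) n
            (fun y => (y - n * thetaSharp ℚ k) ^ 2) 0 ∧
      accExpQ (intSeg n) (probAwayA 1) (fun _ => thetaSharp ℚ k) n
          (fun y => (y - n * thetaSharp ℚ k) ^ 2) 0
        ≤ n * (1 / 4 : ℚ) + (n * (1 / 2 ^ 1 : ℚ)) ^ 2 := by
  have h := stochasticA_one_sharp (intSeg_uniformSeg n) le_rfl one_pos (le_refl n) k
  simp only [mul_one, one_pow, zero_add] at h
  simpa using h

/-- **`sup = LAW`:** for every `n` and every `δ > 0` there is an admissible one-bit `StochasticA` tree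
(`n` summands into `{0, …, n}`, no saturation, gaps `≤ 1`) whose mean-square error exceeds
`n/4 + (n/2)² − δ` — the bound of `stochasticA_one_acc_sq_le` with `G = 1` cannot be lowered. -/
theorem oneBit_sharp_sup (n : ℕ) {δ : ℚ} (hδ : 0 < δ) :
    ∃ x : ℕ → ℚ, NoSat (intSeg n) x n 0 ∧ GapLE (intSeg n) 1 x n 0 ∧
      n * (1 / 4 : ℚ) + (n * (1 / 2 ^ 1 * (1 : ℚ))) ^ 2 - δ
        < accExpQ (intSeg n) (probAwayA 1) x n (fun y => (y - (0 + ∑ i ∈ range n, x i)) ^ 2) 0 := by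
  obtain ⟨k, hk⟩ := exists_nat_gt ((n : ℚ) ^ 2 / (2 * δ))
  obtain ⟨h1, h2, -, h4, -⟩ := oneBit_sharp_every_n n k
  refine ⟨fun _ => thetaSharp ℚ k, h1, h2, ?_⟩
  have hsum : (0 : ℚ) + ∑ i ∈ range n, (fun _ : ℕ => thetaSharp ℚ k) i = n * thetaSharp ℚ k := by
    simp [sum_const, card_range]
  rw [hsum]
  have hlt : (n : ℚ) ^ 2 / (2 * ((k : ℚ) + 2)) < δ := by
    rw [div_lt_iff₀ (by positivity)]
    rw [div_lt_iff₀ (by positivity)] at hk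
    nlinarith
  have e : (n : ℚ) * (1 / 2 ^ 1 * 1) = n * (1 / 2 ^ 1) := by ring
  rw [e]
  linarith

end Summit.Ventures.CertifiedArithmetic.LowPrec.SR.Formats
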